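import Mathlib
import Summits.KontsevichZagierPeriods.KontsevichZagierPeriods.Theorems.SoloInformedHesseChart
import Literature.NumberTheory.Transcendental.KZCalculus
import Literature.NumberTheory.Transcendental.KZSemiCanonicalReductionProofs
import Literature.NumberTheory.Transcendental.KZSemialgebraicComplex
import Literature.NumberTheory.Transcendental.SemialgebraicMapsProofs
import Literature.NumberTheory.Transcendental.SemialgebraicVolume
import HarnessLib
import HarnessLib.Audit

/-!
# SoloInformed — Gauss triplication by the moves, V: the six Weyl chambers of the simplex
The affine `S₃` (permutations of `x, y, z = 1−x−y`) acts on the open simplex `Δ` by six affine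
maps of determinant `±1` permuting the six Weyl chambers; the chamber
`C₀ = {0 < x < z < y}` is a fundamental domain up to the three median lines (Lebesgue-null).
Hence for every representation `D = [Δ, f(xyz)]` with an `S₃`-invariant integrand,
`[D] − 6·[D|_{C₀}] ∈ KZ.relations` (`soloInformed_chambers`): one iterated domain additivity
(rule (1)) and five affine changes of variables (rule (2)).
Residency `solo-KontsevichZagierPeriods-informed` (s71); paper §7 (c6)(x).
References: Kontsevich–Zagier, *Periods* (2001), §1.2 rules (1), (2).
-/

noncomputable section
open MeasureTheory Set Filter
namespace Summit.KontsevichZagierPeriods.KontsevichZagierPeriods.Theorems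

open Literature.NumberTheory.Transcendental Literature.NumberTheory.Transcendental.KZ
open Literature.ModelTheory.ExponentialFields

/-! ### Rule (2) along an affine map of the plane -/

/-- **Rule (2) along an affine map of the plane**: for real-algebraic `M` (`det M ≠ 0`) and `c`,
representations `r`, `r'` with `r'.domain = (M· + c) '' r.domain` and
`r.integrand x = r'.integrand (Mx + c)·|det M|` on `r.domain` differ by a change of variables.
[folklore] -/
theorem soloInformed_affine_sub_mem_changeOfVariablesRel (M : Matrix (Fin 2) (Fin 2) ℝ) (c : Fin 2 → ℝ)
    (hM : ∀ i j, IsAlgebraic ℚ (M i j)) (hc : ∀ i, IsAlgebraic ℚ (c i)) (hdet : M.det ≠ 0)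
    (r r' : IntegralRep 2)
    (hdom : r'.domain = (fun u : Fin 2 → ℝ => Matrix.mulVec M u + c) '' r.domain)
    (hint : ∀ x ∈ r.domain, r.integrand x = r'.integrand (Matrix.mulVec M x + c) * |M.det|) :
    of r - of r' ∈ changeOfVariablesRel := by
  set L : (Fin 2 → ℝ) →L[ℝ] (Fin 2 → ℝ) := LinearMap.toContinuousLinearMap (Matrix.toLin' M) with hL
  have hLapp : ∀ u, L u = Matrix.mulVec M u := fun u => by
    rw [hL, LinearMap.coe_toContinuousLinearMap', Matrix.toLin'_apply]
  have hLdet : L.det = M.det := by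
    rw [ContinuousLinearMap.det, hL, LinearMap.coe_toContinuousLinearMap, LinearMap.det_toLin']
  have hinj : Function.Injective (Matrix.mulVec M) :=
    Matrix.mulVec_injective_iff_isUnit.mpr
      ((Matrix.isUnit_iff_isUnit_det M).mpr (isUnit_iff_ne_zero.mpr hdet))
  -- the affine map is `ℚ`-semialgebraic (algebraic data)
  have hσ := r.isSemialgebraic_domain
  have hsa : IsSemialgebraicMapOn ℚ r.domain (fun u : Fin 2 → ℝ => Matrix.mulVec M u + c) := by
    refine IsSemialgebraicMapOn.of_forall hσ fun i => ?_
    have hx : ∀ j : Fin 2, IsSemialgebraicFunOn ℚ r.domain (fun u : Fin 2 → ℝ => u j) := fun j =>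
      (isSemialgebraicFunOn_aeval hσ (MvPolynomial.X j : MvPolynomial (Fin 2) ℚ)).congr fun u _ => by simp
    have h := IsSemialgebraicFunOn.add_holds (IsSemialgebraicFunOn.add_holds
      (IsSemialgebraicFunOn.mul_holds (isSemialgebraicFunOn_const_of_isAlgebraic hσ (hM i 0)) (hx 0))
      (IsSemialgebraicFunOn.mul_holds (isSemialgebraicFunOn_const_of_isAlgebraic hσ (hM i 1)) (hx 1)))
      (isSemialgebraicFunOn_const_of_isAlgebraic hσ (hc i))
    refine h.congr fun u _ => ?_
    simp only [Pi.add_apply, Pi.mul_apply]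
    change _ = (∑ j, M i j * u j) + c i
    rw [Fin.sum_univ_two]
  refine ⟨2, r, r', fun u => Matrix.mulVec M u + c, fun _ => L, hsa, fun u _ => ?_,
    fun u _ v _ h => hinj (add_right_cancel h), hdom, fun x hx => by rw [hint x hx, hLdet], rfl⟩
  have h : HasFDerivAt (fun u => L u + c) L u := L.hasFDerivAt.add_const c
  simp only [hLapp] at h
  exact h.hasFDerivWithinAt

/-! ### The six chambers -/

/-- The open `2`-simplex `Δ = {u > 0, Σu < 1}` (pinned as in `KZ.exists_dirichletRep`). [this work] -/
def soloInformedOpenSimplex : Set (Fin 2 → ℝ) := {u | (∀ i, 0 < u i) ∧ ∑ i, u i < 1}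
/-- The linear parts of the six affine symmetries `(x,y) ↦ (x,y), (y,x), (x,z), (z,x), (y,z), (z,y)`.
[this work] -/
def soloInformedChamberM : Fin 6 → Matrix (Fin 2) (Fin 2) ℝ :=
  ![!![1, 0; 0, 1], !![0, 1; 1, 0], !![1, 0; -1, -1], !![-1, -1; 1, 0], !![0, 1; -1, -1], !![-1, -1; 0, 1]]
/-- Their translation parts. [this work] -/
def soloInformedChamberC : Fin 6 → (Fin 2 → ℝ) := ![![0, 0], ![0, 0], ![0, 1], ![1, 0], ![0, 1], ![1, 0]]
/-- The six affine symmetries of the simplex. [this work] -/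
def soloInformedChamberMap (k : Fin 6) (u : Fin 2 → ℝ) : Fin 2 → ℝ :=
  Matrix.mulVec (soloInformedChamberM k) u + soloInformedChamberC k
/-- A strict ordering `0 < a < b < c`. [this work] -/
def soloInformedOrd (a b c : ℝ) : Prop := 0 < a ∧ a < b ∧ b < c
/-- The six Weyl chambers `K_k = g_k(C₀)`, by the order type of `(x, y, z)` (`K₀ = C₀`:
`x < z < y`; `K₁ : y < z < x`; `K₂ : x < y < z`; `K₃ : y < x < z`; `K₄ : z < y < x`;
`K₅ : z < x < y`). [this work] -/
def soloInformedChamberSet : Fin 6 → Set (Fin 2 → ℝ) :=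
  ![{w | soloInformedOrd (w 0) (1 - w 0 - w 1) (w 1)}, {w | soloInformedOrd (w 1) (1 - w 0 - w 1) (w 0)},
    {w | soloInformedOrd (w 0) (w 1) (1 - w 0 - w 1)}, {w | soloInformedOrd (w 1) (w 0) (1 - w 0 - w 1)},
    {w | soloInformedOrd (1 - w 0 - w 1) (w 1) (w 0)}, {w | soloInformedOrd (1 - w 0 - w 1) (w 0) (w 1)}]
/-- Coordinates of the six maps. [this work] -/
theorem soloInformedChamberMap_eq (u : Fin 2 → ℝ) :
    soloInformedChamberMap 0 u = ![u 0, u 1] ∧ soloInformedChamberMap 1 u = ![u 1, u 0] ∧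
      soloInformedChamberMap 2 u = ![u 0, 1 - u 0 - u 1] ∧ soloInformedChamberMap 3 u = ![1 - u 0 - u 1, u 0] ∧
      soloInformedChamberMap 4 u = ![u 1, 1 - u 0 - u 1] ∧ soloInformedChamberMap 5 u = ![1 - u 0 - u 1, u 1] := by
  refine ⟨?_, ?_, ?_, ?_, ?_, ?_⟩
  all_goals
    funext i
    fin_cases i <;>
      simp [soloInformedChamberMap, soloInformedChamberM, soloInformedChamberC, dotProduct, Fin.sum_univ_two] <;>
      ring
/-- Membership in the six chambers. [this work] -/
theorem soloInformed_mem_chamberSet (w : Fin 2 → ℝ) :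
    (w ∈ soloInformedChamberSet 0 ↔ soloInformedOrd (w 0) (1 - w 0 - w 1) (w 1)) ∧
      (w ∈ soloInformedChamberSet 1 ↔ soloInformedOrd (w 1) (1 - w 0 - w 1) (w 0)) ∧
      (w ∈ soloInformedChamberSet 2 ↔ soloInformedOrd (w 0) (w 1) (1 - w 0 - w 1)) ∧
      (w ∈ soloInformedChamberSet 3 ↔ soloInformedOrd (w 1) (w 0) (1 - w 0 - w 1)) ∧
      (w ∈ soloInformedChamberSet 4 ↔ soloInformedOrd (1 - w 0 - w 1) (w 1) (w 0)) ∧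
      (w ∈ soloInformedChamberSet 5 ↔ soloInformedOrd (1 - w 0 - w 1) (w 0) (w 1)) := by
  simp [soloInformedChamberSet]
/-- `K₀ = C₀`. [this work] -/
theorem soloInformed_chamberSet_zero : soloInformedChamberSet 0 = soloInformedC0 := by
  ext w
  rw [(soloInformed_mem_chamberSet w).1]
  rfl
/-- `|det M_k| = 1`. [this work] -/
theorem soloInformed_abs_det_chamberM (k : Fin 6) : |(soloInformedChamberM k).det| = 1 := by
  fin_cases k <;> simp [soloInformedChamberM, Matrix.det_fin_two]
/-- The entries of `M_k` and `c_k` are real algebraic (integers). [this work] -/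
theorem soloInformed_isAlgebraic_chamber (k : Fin 6) :
    (∀ i j, IsAlgebraic ℚ (soloInformedChamberM k i j)) ∧ ∀ i, IsAlgebraic ℚ (soloInformedChamberC k i) := by
  have h0 : IsAlgebraic ℚ (0:ℝ) := isAlgebraic_zero
  have h1 : IsAlgebraic ℚ (1:ℝ) := isAlgebraic_one
  have hm : IsAlgebraic ℚ (-1:ℝ) := isAlgebraic_one.neg
  constructor
  · intro i j
    fin_cases k <;> fin_cases i <;> fin_cases j <;> simp [soloInformedChamberM] <;> assumption
  · intro i
    fin_cases k <;> fin_cases i <;> simp [soloInformedChamberC] <;> assumption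
/-- The six chambers are `ℚ`-semialgebraic. [this work] -/
theorem soloInformed_isSemialgebraic_chamberSet (k : Fin 6) : IsSemialgebraic ℚ (soloInformedChamberSet k) := by
  have key : ∀ (p q r : MvPolynomial (Fin 2) ℚ),
      IsSemialgebraic ℚ {w : Fin 2 → ℝ | soloInformedOrd (MvPolynomial.aeval w p) (MvPolynomial.aeval w q)
        (MvPolynomial.aeval w r)} := by
    intro p q r
    have h := isSemialgebraic_setOf_forall_aeval_pos ![p, q - p, r - q]
    convert h using 1
    ext w
    simp only [soloInformedOrd, mem_setOf_eq, Fin.forall_fin_succ, Matrix.cons_val_zero, Matrix.cons_val_succ,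
      map_sub, sub_pos]
    exact ⟨fun ⟨a, b, c⟩ => ⟨a, b, c, fun i => Fin.elim0 i⟩, fun ⟨a, b, c, _⟩ => ⟨a, b, c⟩⟩
  have hX0 : ∀ w : Fin 2 → ℝ, MvPolynomial.aeval w (MvPolynomial.X 0 : MvPolynomial (Fin 2) ℚ) = w 0 :=
    fun w => by simp
  have hX1 : ∀ w : Fin 2 → ℝ, MvPolynomial.aeval w (MvPolynomial.X 1 : MvPolynomial (Fin 2) ℚ) = w 1 :=
    fun w => by simp
  have hZ : ∀ w : Fin 2 → ℝ,
      MvPolynomial.aeval w (1 - MvPolynomial.X 0 - MvPolynomial.X 1 : MvPolynomial (Fin 2) ℚ) = 1 - w 0 - w 1 :=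
    fun w => by simp
  fin_cases k
  · convert key (MvPolynomial.X 0) (1 - MvPolynomial.X 0 - MvPolynomial.X 1) (MvPolynomial.X 1) using 1
    ext w; simp only [soloInformedChamberSet, mem_setOf_eq, hX0, hX1, hZ]; simp [soloInformedOrd]
  · convert key (MvPolynomial.X 1) (1 - MvPolynomial.X 0 - MvPolynomial.X 1) (MvPolynomial.X 0) using 1
    ext w; simp only [soloInformedChamberSet, mem_setOf_eq, hX0, hX1, hZ]; simp [soloInformedOrd]
  · convert key (MvPolynomial.X 0) (MvPolynomial.X 1) (1 - MvPolynomial.X 0 - MvPolynomial.X 1) using 1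
    ext w; simp only [soloInformedChamberSet, mem_setOf_eq, hX0, hX1, hZ]; simp [soloInformedOrd]
  · convert key (MvPolynomial.X 1) (MvPolynomial.X 0) (1 - MvPolynomial.X 0 - MvPolynomial.X 1) using 1
    ext w; simp only [soloInformedChamberSet, mem_setOf_eq, hX0, hX1, hZ]; simp [soloInformedOrd]
  · convert key (1 - MvPolynomial.X 0 - MvPolynomial.X 1) (MvPolynomial.X 1) (MvPolynomial.X 0) using 1
    ext w; simp only [soloInformedChamberSet, mem_setOf_eq, hX0, hX1, hZ]; simp [soloInformedOrd]
  · convert key (1 - MvPolynomial.X 0 - MvPolynomial.X 1) (MvPolynomial.X 0) (MvPolynomial.X 1) using 1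
    ext w; simp only [soloInformedChamberSet, mem_setOf_eq, hX0, hX1, hZ]; simp [soloInformedOrd]
/-- `g_k(C₀) = K_k`. [this work] -/
theorem soloInformed_image_chamberMap (k : Fin 6) :
    soloInformedChamberMap k '' soloInformedC0 = soloInformedChamberSet k := by
  have E := soloInformedChamberMap_eq
  have M := soloInformed_mem_chamberSet
  ext w
  fin_cases k
  · show w ∈ soloInformedChamberMap 0 '' soloInformedC0 ↔ w ∈ soloInformedChamberSet 0
    rw [(M w).1]
    constructor
    · rintro ⟨u, ⟨ha, hb, hc⟩, rfl⟩
      rw [(E u).1]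
      refine ⟨?_, ?_, ?_⟩ <;> simp <;> linarith
    · rintro ⟨ha, hb, hc⟩
      refine ⟨![w 0, w 1], ⟨?_, ?_, ?_⟩, ?_⟩
      · simp; linarith
      · simp; linarith
      · simp; linarith
      · rw [(E _).1]
        funext i; fin_cases i <;> simp
  · show w ∈ soloInformedChamberMap 1 '' soloInformedC0 ↔ w ∈ soloInformedChamberSet 1
    rw [(M w).2.1]
    constructor
    · rintro ⟨u, ⟨ha, hb, hc⟩, rfl⟩
      rw [(E u).2.1]
      refine ⟨?_, ?_, ?_⟩ <;> simp <;> linarith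
    · rintro ⟨ha, hb, hc⟩
      refine ⟨![w 1, w 0], ⟨?_, ?_, ?_⟩, ?_⟩
      · simp; linarith
      · simp; linarith
      · simp; linarith
      · rw [(E _).2.1]
        funext i; fin_cases i <;> simp
  · show w ∈ soloInformedChamberMap 2 '' soloInformedC0 ↔ w ∈ soloInformedChamberSet 2
    rw [(M w).2.2.1]
    constructor
    · rintro ⟨u, ⟨ha, hb, hc⟩, rfl⟩
      rw [(E u).2.2.1]
      refine ⟨?_, ?_, ?_⟩ <;> simp <;> linarith
    · rintro ⟨ha, hb, hc⟩
      refine ⟨![w 0, 1 - w 0 - w 1], ⟨?_, ?_, ?_⟩, ?_⟩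
      · simp; linarith
      · simp; linarith
      · simp; linarith
      · rw [(E _).2.2.1]
        funext i; fin_cases i <;> simp
  · show w ∈ soloInformedChamberMap 3 '' soloInformedC0 ↔ w ∈ soloInformedChamberSet 3
    rw [(M w).2.2.2.1]
    constructor
    · rintro ⟨u, ⟨ha, hb, hc⟩, rfl⟩
      rw [(E u).2.2.2.1]
      refine ⟨?_, ?_, ?_⟩ <;> simp <;> linarith
    · rintro ⟨ha, hb, hc⟩
      refine ⟨![w 1, 1 - w 0 - w 1], ⟨?_, ?_, ?_⟩, ?_⟩
      · simp; linarith
      · simp; linarith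
      · simp; linarith
      · rw [(E _).2.2.2.1]
        funext i; fin_cases i <;> simp
  · show w ∈ soloInformedChamberMap 4 '' soloInformedC0 ↔ w ∈ soloInformedChamberSet 4
    rw [(M w).2.2.2.2.1]
    constructor
    · rintro ⟨u, ⟨ha, hb, hc⟩, rfl⟩
      rw [(E u).2.2.2.2.1]
      refine ⟨?_, ?_, ?_⟩ <;> simp <;> linarith
    · rintro ⟨ha, hb, hc⟩
      refine ⟨![1 - w 0 - w 1, w 0], ⟨?_, ?_, ?_⟩, ?_⟩
      · simp; linarith
      · simp; linarith
      · simp; linarith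
      · rw [(E _).2.2.2.2.1]
        funext i; fin_cases i <;> simp
        ring
  · show w ∈ soloInformedChamberMap 5 '' soloInformedC0 ↔ w ∈ soloInformedChamberSet 5
    rw [(M w).2.2.2.2.2]
    constructor
    · rintro ⟨u, ⟨ha, hb, hc⟩, rfl⟩
      rw [(E u).2.2.2.2.2]
      refine ⟨?_, ?_, ?_⟩ <;> simp <;> linarith
    · rintro ⟨ha, hb, hc⟩
      refine ⟨![1 - w 0 - w 1, w 1], ⟨?_, ?_, ?_⟩, ?_⟩
      · simp; linarith
      · simp; linarith
      · simp; linarith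
      · rw [(E _).2.2.2.2.2]
        funext i; fin_cases i <;> simp
        ring
/-- The six maps preserve `F = xyz`. [this work] -/
theorem soloInformed_hesseF_chamberMap (k : Fin 6) (u : Fin 2 → ℝ) :
    soloInformedChamberMap k u 0 * soloInformedChamberMap k u 1 *
        (1 - soloInformedChamberMap k u 0 - soloInformedChamberMap k u 1) = u 0 * u 1 * (1 - u 0 - u 1) := by
  have E := soloInformedChamberMap_eq u
  fin_cases k
  · show soloInformedChamberMap 0 u 0 * soloInformedChamberMap 0 u 1 *
        (1 - soloInformedChamberMap 0 u 0 - soloInformedChamberMap 0 u 1) = _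
    rw [E.1]; simp only [Matrix.cons_val_zero, Matrix.cons_val_one]
  · show soloInformedChamberMap 1 u 0 * soloInformedChamberMap 1 u 1 *
        (1 - soloInformedChamberMap 1 u 0 - soloInformedChamberMap 1 u 1) = _
    rw [E.2.1]; simp only [Matrix.cons_val_zero, Matrix.cons_val_one]; ring
  · show soloInformedChamberMap 2 u 0 * soloInformedChamberMap 2 u 1 *
        (1 - soloInformedChamberMap 2 u 0 - soloInformedChamberMap 2 u 1) = _
    rw [E.2.2.1]; simp only [Matrix.cons_val_zero, Matrix.cons_val_one]; ring
  · show soloInformedChamberMap 3 u 0 * soloInformedChamberMap 3 u 1 *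
        (1 - soloInformedChamberMap 3 u 0 - soloInformedChamberMap 3 u 1) = _
    rw [E.2.2.2.1]; simp only [Matrix.cons_val_zero, Matrix.cons_val_one]; ring
  · show soloInformedChamberMap 4 u 0 * soloInformedChamberMap 4 u 1 *
        (1 - soloInformedChamberMap 4 u 0 - soloInformedChamberMap 4 u 1) = _
    rw [E.2.2.2.2.1]; simp only [Matrix.cons_val_zero, Matrix.cons_val_one]; ring
  · show soloInformedChamberMap 5 u 0 * soloInformedChamberMap 5 u 1 *
        (1 - soloInformedChamberMap 5 u 0 - soloInformedChamberMap 5 u 1) = _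
    rw [E.2.2.2.2.2]; simp only [Matrix.cons_val_zero, Matrix.cons_val_one]; ring
/-- The six maps send `C₀` into the simplex. [this work] -/
theorem soloInformed_chamberSet_subset_simplex (k : Fin 6) : soloInformedChamberSet k ⊆ soloInformedOpenSimplex := by
  intro w hw
  have M := soloInformed_mem_chamberSet w
  have key : 0 < w 0 ∧ 0 < w 1 ∧ w 0 + w 1 < 1 := by
    fin_cases k
    · obtain ⟨ha, hb, hc⟩ := (M.1).1 hw
      exact ⟨by linarith, by linarith, by linarith⟩
    · obtain ⟨ha, hb, hc⟩ := (M.2.1).1 hw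
      exact ⟨by linarith, by linarith, by linarith⟩
    · obtain ⟨ha, hb, hc⟩ := (M.2.2.1).1 hw
      exact ⟨by linarith, by linarith, by linarith⟩
    · obtain ⟨ha, hb, hc⟩ := (M.2.2.2.1).1 hw
      exact ⟨by linarith, by linarith, by linarith⟩
    · obtain ⟨ha, hb, hc⟩ := (M.2.2.2.2.1).1 hw
      exact ⟨by linarith, by linarith, by linarith⟩
    · obtain ⟨ha, hb, hc⟩ := (M.2.2.2.2.2).1 hw
      exact ⟨by linarith, by linarith, by linarith⟩
  refine ⟨?_, ?_⟩
  · intro i; fin_cases i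
    · exact key.1
    · exact key.2.1
  · rw [Fin.sum_univ_two]; exact key.2.2
/-- The six chambers are pairwise disjoint. [this work] -/
theorem soloInformed_chamberSet_disjoint {i j : Fin 6} (hij : i ≠ j) :
    soloInformedChamberSet i ∩ soloInformedChamberSet j = ∅ := by
  apply eq_empty_of_forall_notMem
  rintro w ⟨hi, hj⟩
  fin_cases i <;> fin_cases j
  all_goals first
    | exact hij rfl
    | (obtain ⟨a1, a2, a3⟩ := hi
       obtain ⟨b1, b2, b3⟩ := hj
       linarith)
/-- Off the three median lines, a point of the simplex lies in one of the six chambers. [this work] -/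
theorem soloInformed_exists_chamber {w : Fin 2 → ℝ} (hw : w ∈ soloInformedOpenSimplex) (h01 : w 0 ≠ w 1)
    (h02 : w 0 ≠ 1 - w 0 - w 1) (h12 : w 1 ≠ 1 - w 0 - w 1) : ∃ k, w ∈ soloInformedChamberSet k := by
  obtain ⟨hpos, hsum⟩ := hw
  have h0 := hpos 0
  have h1 := hpos 1
  rw [Fin.sum_univ_two] at hsum
  have h2 : 0 < 1 - w 0 - w 1 := by linarith
  have M := soloInformed_mem_chamberSet w
  rcases lt_or_gt_of_ne h01 with a | a <;> rcases lt_or_gt_of_ne h02 with b | b <;> rcases lt_or_gt_of_ne h12 with c | c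
  all_goals first
    | exact ⟨0, M.1.2 ⟨h0, b, c⟩⟩
    | exact ⟨1, M.2.1.2 ⟨h1, c, b⟩⟩
    | exact ⟨2, M.2.2.1.2 ⟨h0, a, c⟩⟩
    | exact ⟨3, M.2.2.2.1.2 ⟨h1, a, b⟩⟩
    | exact ⟨4, M.2.2.2.2.1.2 ⟨h2, c, a⟩⟩
    | exact ⟨5, M.2.2.2.2.2.2 ⟨h2, b, a⟩⟩
/-- The simplex minus the six chambers is Lebesgue-null (inside three lines). [this work] -/
theorem soloInformed_volume_simplex_diff_chambers :
    volume (soloInformedOpenSimplex \ ⋃ k ∈ (Finset.univ : Finset (Fin 6)), soloInformedChamberSet k) = 0 := by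
  set q : MvPolynomial (Fin 2) ℚ := (MvPolynomial.X 0 - MvPolynomial.X 1) *
    (MvPolynomial.C 2 * MvPolynomial.X 0 + MvPolynomial.X 1 - 1) *
    (MvPolynomial.X 0 + MvPolynomial.C 2 * MvPolynomial.X 1 - 1) with hq
  have hq0 : MvPolynomial.map (algebraMap ℚ ℝ) q ≠ 0 := by
    intro h
    have := congrArg (MvPolynomial.eval ![(2:ℝ), 0]) h
    rw [MvPolynomial.eval_map, ← MvPolynomial.aeval_def] at this
    norm_num [hq] at this
  refine measure_mono_null (fun w hw => ?_) (volume_setOf_aeval_eq_zero q hq0)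
  obtain ⟨hwΔ, hwU⟩ := hw
  simp only [mem_setOf_eq, hq, map_mul, map_sub, map_add, map_one, MvPolynomial.aeval_X, MvPolynomial.aeval_C,
    eq_ratCast, Rat.cast_ofNat]
  by_contra hne
  obtain ⟨hd, hm⟩ := mul_ne_zero_iff.1 hne
  obtain ⟨hd, hn⟩ := mul_ne_zero_iff.1 hd
  obtain ⟨k, hk⟩ := soloInformed_exists_chamber hwΔ (fun h => hd (by linarith))
    (fun h => hn (by linarith)) (fun h => hm (by linarith))
  exact hwU (mem_iUnion₂.2 ⟨k, Finset.mem_univ k, hk⟩)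
/-- **The six chambers.** For a representation `D` on the simplex with an `S₃`-invariant integrand
`f(xyz)`: `[D] − 6·[D|_{C₀}] ∈ KZ.relations`. [this work] -/
theorem soloInformed_chambers (f : ℝ → ℝ) (D : IntegralRep 2) (hDd : D.domain = soloInformedOpenSimplex)
    (hDi : EqOn D.integrand (fun w => f (w 0 * w 1 * (1 - w 0 - w 1))) D.domain)
    (hsub : soloInformedC0 ⊆ D.domain) :
    of D - 6 • of (D.restrict soloInformedC0 soloInformed_isSemialgebraic_C0 hsub) ∈ relations := by
  have hsubk : ∀ k, soloInformedChamberSet k ⊆ D.domain := fun k => by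
    rw [hDd]; exact soloInformed_chamberSet_subset_simplex k
  set R : Fin 6 → IntegralRep 2 := fun k =>
    D.restrict (soloInformedChamberSet k) (soloInformed_isSemialgebraic_chamberSet k) (hsubk k) with hR
  set R0 := D.restrict soloInformedC0 soloInformed_isSemialgebraic_C0 hsub with hR0
  -- rule (1): [D] − Σ_k [R k]
  have hsum : of D - ∑ k ∈ (Finset.univ : Finset (Fin 6)), of (R k) ∈ relations := by
    refine of_sub_sum_of_mem_relations Finset.univ D R (fun k _ => ?_) (fun k _ => fun _ _ => rfl) ?_ ?_
    · have : (R k).domain \ D.domain = ∅ := eq_empty_of_forall_notMem fun x hx => hx.2 (hsubk k hx.1)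
      rw [this, measure_empty]
    · simpa [hR, hDd] using soloInformed_volume_simplex_diff_chambers
    · intro i _ j _ hij
      change volume (soloInformedChamberSet i ∩ soloInformedChamberSet j) = 0
      rw [soloInformed_chamberSet_disjoint hij, measure_empty]
  -- rule (2): [R0] − [R k] along g_k
  have hmove : ∀ k, of R0 - of (R k) ∈ relations := by
    intro k
    obtain ⟨hM, hc⟩ := soloInformed_isAlgebraic_chamber k
    have hdet : (soloInformedChamberM k).det ≠ 0 := by
      intro h; have := soloInformed_abs_det_chamberM k; rw [h, abs_zero] at this; exact zero_ne_one this
    refine changeOfVariablesRel_subset_relations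
      (soloInformed_affine_sub_mem_changeOfVariablesRel _ _ hM hc hdet R0 (R k) ?_ fun u hu => ?_)
    · change soloInformedChamberSet k = (fun u => soloInformedChamberMap k u) '' soloInformedC0
      exact (soloInformed_image_chamberMap k).symm
    · have huC : u ∈ soloInformedC0 := hu
      have huΔ : u ∈ D.domain := hsub huC
      have hgu : soloInformedChamberMap k u ∈ D.domain :=
        hsubk k (by rw [← soloInformed_image_chamberMap]; exact mem_image_of_mem _ huC)
      change D.integrand u = D.integrand (soloInformedChamberMap k u) * |(soloInformedChamberM k).det|
      rw [soloInformed_abs_det_chamberM, mul_one, hDi huΔ, hDi hgu]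
      simp only [soloInformed_hesseF_chamberMap]
  have h6 : ∑ k ∈ (Finset.univ : Finset (Fin 6)), of (R k) - 6 • of R0 ∈ relations := by
    have : ∑ k ∈ (Finset.univ : Finset (Fin 6)), of (R k) - 6 • of R0 =
        ∑ k ∈ (Finset.univ : Finset (Fin 6)), (of (R k) - of R0) := by
      rw [Finset.sum_sub_distrib, Finset.sum_const, Finset.card_univ, Fintype.card_fin]
    rw [this]
    exact sum_mem fun k _ => by
      have := relations.neg_mem (hmove k)
      rwa [neg_sub] at this
  have : of D - 6 • of R0 = (of D - ∑ k ∈ (Finset.univ : Finset (Fin 6)), of (R k)) +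
      (∑ k ∈ (Finset.univ : Finset (Fin 6)), of (R k) - 6 • of R0) := by abel
  rw [this]
  exact relations.add_mem hsum h6

end Summit.KontsevichZagierPeriods.KontsevichZagierPeriods.Theorems
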